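import Literature.NumberTheory.Sieve.LargeSieveCharacters
import Literature.NumberTheory.Sieve.VaughanMeanValueDecomposition

/-!
# Vaughan's mean value theorem (discharge of `Literature.NumberTheory.Sieve.vaughan_meanValue`)

This file proves the named fact `Literature.NumberTheory.Sieve.vaughan_meanValue`
(`BombieriVinogradovFacts.lean`; Vaughan, *An elementary method in prime number theory*,
Acta Arith. 37 (1980), 111–115, Theorem 1) with an explicit constant:

  `∑_{q ≤ Q} (q/φ(q)) ∑*_{χ mod q} max_{y ≤ Y} |ψ(y, χ)|`
  `    ≤ 10⁵ (Y + Y^{5/6} Q + Y^{1/2} Q²) (log YQ)⁴`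

for all integers `Q ≥ 1` and real `Y ≥ 2` (`vaughan_meanValue_holds`), and records the
consequence that the Bombieri–Vinogradov theorem `Literature.NumberTheory.Sieve.bombieri_vinogradov` (parity.S27)
now only depends on the Siegel–Walfisz theorem (`bombieri_vinogradov_of_siegelWalfisz`, from the
reduction `bombieri_vinogradov_of_vaughan_of_siegelWalfisz` of
`BombieriVinogradovReduction.lean`). The decomposition `ψ = ψ(min(U,·)) + S₁ − S₂' − S₂'' + S₃`,
the weighted sum `T` and the dyadic blocks are set up in `VaughanMeanValueDecomposition.lean`;
the large-sieve and Pólya–Vinogradov inputs come from `LargeSieveCharacters.lean`.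

## Contents

* `norm_sum_Ioc_char_le`, `norm_sum_Ioc_log_mul_char_le`: Pólya–Vinogradov on an interval and
  its log-weighted form (Abel summation);
* `Tfun_S₁_le`, `Tfun_S₂'_le`: `T(S₁), T(S₂') ≤ Y₀ ℓ² + U ℓ Q^{5/2} (1 + log Q)`
  (`ℓ = 1 + log ⌊Y⌋`);
* `Tfun_blockSum_le_hyperbolic`, `Tfun_blockSum_le`: Vaughan's Lemma 2 on a dyadic block, from
  `largeSieve_bilinear_hyperbolic`, with `2 + log P ≤ 5ℓ` (`two_add_log_sepModulus_le`);
* `Tfun_S₃_le` (`≤ 140 ℓ⁴ √Y₀ (√Y₀ + 2Q√Y₀/√U + Q²)`) and `Tfun_S₂''_le`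
  (`≤ 40 ℓ³ √Y₀ (√Y₀ + UQ + Q√Y₀/√U + Q²)`), summing `≤ 2ℓ` blocks;
* `Tfun_psi_le_of_lt_sq`: the case `Q² > ⌊Y⌋`, `T(ψ) ≤ 50 Q² √Y₀ ℓ²` (Lemma 2 with `M = 1`);
* `Tfun_psi_le_pieces`: the case `Q² ≤ ⌊Y⌋`, `T(ψ) ≤` the sum of the five pieces;
* `alg_W`, `vaughan_meanValue_holds`, `bombieri_vinogradov_of_siegelWalfisz`.

## The argument and where it deviates from the printed proof

We follow Vaughan's paper with `u = min(Y^{1/3}, Y Q⁻²)`, `U = ⌊u⌋` (the third member `Q²` of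
Vaughan's (10) is only used there for his (11), which we replace by the trivial bound
`T(ψ(min(U, ·), ·)) ≤ 6 U Q² ≤ 6 Y`). The sums `S₁`, `S₂'` (`d ≤ U`) are bounded pointwise by
the Pólya–Vinogradov inequality for `q ≥ 2` and trivially for `q = 1`; the sums `S₂''`
(`U < d ≤ U²`) and `S₃` (`d, m > U`) are cut into `≤ 2ℓ` dyadic blocks `M < d ≤ 2M`, each of
which is a bilinear form with the hyperbolic cut-off `dm ≤ X(q, χ)` and is bounded by
`largeSieve_bilinear_hyperbolic` (the separation of variables there is arithmetic, not by
Perron's formula, at the same logarithmic cost), with the crude mean values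
`∑ τ(m)² ≤ K(1 + log K)³` and `∑ Λ(n)² ≤ 6 K log K`. All logarithms are then converted into
`log(YQ) ≥ log 2` and the monomials `U Q²`, `U Q^{5/2}`, `Y^{1/2} U Q`, `Y Q U^{-1/2}` into
`Y + Y^{5/6} Q + Y^{1/2} Q²` through `A = Y^{1/6}` (`alg_W`); no attempt is made to optimise
the numerical constant `10⁵`.

## References

* R. C. Vaughan, *An elementary method in prime number theory*, Acta Arith. 37 (1980),
  111–115, Theorem 1 and Theorem 3, Lemmas 1–2, (10)–(15). [Vaughan1980]
* H. Davenport, *Multiplicative Number Theory*, 2nd ed. (Springer, 1980), ch. 28.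
  [DavenportMNT1980]
* A. C. Cojocaru, M. R. Murty, *An Introduction to Sieve Methods and their Applications*
  (CUP, 2005), (8.14) and §9.2. [CojocaruMurty2005]
-/

open Finset Real Complex
open scoped ComplexConjugate FourierTransform

namespace Literature.NumberTheory.Sieve.Vaughan

open ArithmeticFunction LargeSieve
open scoped ArithmeticFunction.Moebius ArithmeticFunction.zeta ArithmeticFunction.sigma

/-! ### Character sums over intervals (Pólya–Vinogradov) -/

/-- Pólya–Vinogradov on an arbitrary interval `(A, B]`. [cite: CojocaruMurty2005, (8.14)] -/
theorem norm_sum_Ioc_char_le {q : ℕ} (hq : 2 ≤ q) {χ : DirichletCharacter ℂ q}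
    (hχ : χ.IsPrimitive) (A B : ℕ) :
    ‖∑ m ∈ Ioc A B, χ m‖ ≤ Real.sqrt q * (1 + Real.log q) := by
  rcases le_or_gt A B with h | h
  · obtain ⟨N, rfl⟩ := Nat.exists_eq_add_of_le h
    exact polyaVinogradov hq hχ A N
  · rw [Finset.Ioc_eq_empty (by omega), sum_empty, norm_zero]
    have : 0 ≤ Real.log q := Real.log_nonneg (by exact_mod_cast (by omega : 1 ≤ q))
    positivity

/-- **Log-weighted Pólya–Vinogradov**: for `χ` primitive mod `q ≥ 2`,
`|∑_{m ≤ Z} (log m) χ(m)| ≤ √q (1 + log q) log Z` (Abel summation). [folklore] -/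
theorem norm_sum_Ioc_log_mul_char_le {q : ℕ} (hq : 2 ≤ q) {χ : DirichletCharacter ℂ q}
    (hχ : χ.IsPrimitive) (Z : ℕ) :
    ‖∑ m ∈ Ioc 0 Z, (Real.log m : ℂ) * χ m‖ ≤ Real.sqrt q * (1 + Real.log q) * Real.log Z := by
  set Δ : ℕ → ℝ := fun j => Real.log j - Real.log (j - 1 : ℕ) with hΔ
  have hswap : ∑ m ∈ Ioc 0 Z, (Real.log m : ℂ) * χ m =
      ∑ j ∈ Ioc 0 Z, (Δ j : ℂ) * ∑ m ∈ Ioc (j - 1) Z, χ m := by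
    have h1 : ∀ m ∈ Ioc 0 Z, (Real.log m : ℂ) * χ m = ∑ j ∈ Ioc 0 m, (Δ j : ℂ) * χ m := by
      intro m _
      rw [log_eq_sum_Ioc_sub m, Complex.ofReal_sum, sum_mul]
    rw [sum_congr rfl h1, Finset.sum_comm' (t' := Ioc 0 Z) (s' := fun j => Ioc (j - 1) Z)]
    · exact sum_congr rfl fun j _ => by rw [mul_sum]
    · intro m j
      simp only [mem_Ioc]
      omega
  rw [hswap]
  have hPV := norm_sum_Ioc_char_le hq hχ
  have hC : 0 ≤ Real.sqrt q * (1 + Real.log q) := by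
    have : 0 ≤ Real.log q := Real.log_nonneg (by exact_mod_cast (by omega : 1 ≤ q))
    positivity
  calc ‖∑ j ∈ Ioc 0 Z, (Δ j : ℂ) * ∑ m ∈ Ioc (j - 1) Z, χ m‖
      ≤ ∑ j ∈ Ioc 0 Z, Δ j * (Real.sqrt q * (1 + Real.log q)) := by
        refine (norm_sum_le _ _).trans (sum_le_sum fun j _ => ?_)
        rw [norm_mul, Complex.norm_real, Real.norm_of_nonneg (log_sub_log_pred_nonneg j)]
        exact mul_le_mul_of_nonneg_left (hPV _ _) (log_sub_log_pred_nonneg j)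
    _ = Real.sqrt q * (1 + Real.log q) * Real.log Z := by
        rw [← sum_mul, ← log_eq_sum_Ioc_sub]; ring

/-! ### The pieces `S₁` and `S₂'` -/

/-- For primitive `χ mod q ≥ 2`: `‖S₁(X, χ)‖ ≤ U ℓ √q (1 + log q)` (log-weighted
Pólya–Vinogradov). [folklore] -/
theorem norm_S₁_le_of_isPrimitive {U X Y₀ : ℕ} (hX : X ≤ Y₀) {q : ℕ} (hq : 2 ≤ q)
    {χ : DirichletCharacter ℂ q} (hχ : χ.IsPrimitive) :
    ‖S₁ U X χ‖ ≤ U * ell Y₀ * (Real.sqrt q * (1 + Real.log q)) := by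
  refine (norm_S₁_le U X χ).trans ?_
  have hlq : 0 ≤ Real.log q := Real.log_natCast_nonneg q
  calc ∑ d ∈ Ioc 0 U, ‖∑ m ∈ Ioc 0 (X / d), (Real.log m : ℂ) * χ m‖
      ≤ ∑ d ∈ Ioc 0 U, ell Y₀ * (Real.sqrt q * (1 + Real.log q)) := by
        refine sum_le_sum fun d _ => ?_
        refine (norm_sum_Ioc_log_mul_char_le hq hχ _).trans ?_
        rw [mul_comm (ell Y₀)]
        refine mul_le_mul_of_nonneg_left (log_le_ell ((Nat.div_le_self X d).trans hX)) ?_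
        positivity
    _ = U * ell Y₀ * (Real.sqrt q * (1 + Real.log q)) := by
        rw [sum_const, Nat.card_Ioc, Nat.sub_zero, nsmul_eq_mul]; ring

/-- **The piece `S₁`**: `T(S₁) ≤ Y₀ ℓ² + U ℓ Q^{5/2} (1 + log Q)`. [cite: Vaughan1980, §2] -/
theorem Tfun_S₁_le {Q U Y₀ : ℕ} (hQ : 1 ≤ Q) (hU : U ≤ Y₀)
    (X : (q : ℕ) → DirichletCharacter ℂ q → ℕ) (hX : ∀ q χ, X q χ ≤ Y₀) :
    Tfun Q (fun q χ => S₁ U (X q χ) χ) ≤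
      Y₀ * ell Y₀ ^ 2 + U * ell Y₀ * ((Q : ℝ) ^ 2 * Real.sqrt Q * (1 + Real.log Q)) :=
  Tfun_le_of_le_one_of_le hQ (by have := ell_nonneg Y₀; positivity)
    (by have := ell_nonneg Y₀; positivity)
    (fun χ => norm_S₁_le_trivial (hX 1 χ) hU χ)
    (fun q hq _ χ hχ => norm_S₁_le_of_isPrimitive (hX q χ) hq hχ)

/-- For primitive `χ mod q ≥ 2`: `‖S₂'(X, χ)‖ ≤ U ℓ √q (1 + log q)` (Pólya–Vinogradov).
[folklore] -/
theorem norm_S₂'_le_of_isPrimitive {U X Y₀ : ℕ} (hU : U ≤ Y₀) {q : ℕ} (hq : 2 ≤ q)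
    {χ : DirichletCharacter ℂ q} (hχ : χ.IsPrimitive) :
    ‖S₂' U X χ‖ ≤ U * ell Y₀ * (Real.sqrt q * (1 + Real.log q)) := by
  refine (norm_S₂'_le hU χ).trans ?_
  have hℓ := ell_nonneg Y₀
  calc ell Y₀ * ∑ d ∈ Ioc 0 U, ‖∑ m ∈ Ioc 0 (X / d), χ m‖
      ≤ ell Y₀ * ∑ d ∈ Ioc 0 U, (Real.sqrt q * (1 + Real.log q)) :=
        mul_le_mul_of_nonneg_left (sum_le_sum fun d _ => norm_sum_Ioc_char_le hq hχ 0 _) hℓ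
    _ = _ := by rw [sum_const, Nat.card_Ioc, Nat.sub_zero, nsmul_eq_mul]; ring

/-- **The piece `S₂'`**: `T(S₂') ≤ Y₀ ℓ² + U ℓ Q^{5/2} (1 + log Q)`. [cite: Vaughan1980, §2] -/
theorem Tfun_S₂'_le {Q U Y₀ : ℕ} (hQ : 1 ≤ Q) (hU : U ≤ Y₀)
    (X : (q : ℕ) → DirichletCharacter ℂ q → ℕ) (hX : ∀ q χ, X q χ ≤ Y₀) :
    Tfun Q (fun q χ => S₂' U (X q χ) χ) ≤
      Y₀ * ell Y₀ ^ 2 + U * ell Y₀ * ((Q : ℝ) ^ 2 * Real.sqrt Q * (1 + Real.log Q)) :=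
  Tfun_le_of_le_one_of_le hQ (by have := ell_nonneg Y₀; positivity)
    (by have := ell_nonneg Y₀; positivity)
    (fun χ => norm_S₂'_le_trivial (hX 1 χ) hU χ)
    (fun q hq _ χ hχ => norm_S₂'_le_of_isPrimitive hU hq hχ)

/-! ### Type II blocks: Vaughan's Lemma 2 and the pieces `S₃`, `S₂''` -/

/-- **Vaughan's Lemma 2 on a block**:
`T(B_M) ≤ (2 + log P) ((M+1+2Q²) ∑ a(d)²)^{1/2} ((Y₀/M+1+2Q²) ∑ b(m)²)^{1/2}`,
`P = sepModulus (4(Y₀+1)) (2M) (Y₀/M)`. [cite: Vaughan1980, Lemma 2] -/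
theorem Tfun_blockSum_le_hyperbolic (a b : ℕ → ℝ) {Q M Y₀ : ℕ} (hM : 0 < M)
    (X : (q : ℕ) → DirichletCharacter ℂ q → ℕ) (hX : ∀ q χ, X q χ ≤ Y₀) :
    Tfun Q (fun q χ => blockSum a b M (X q χ) χ) ≤
      (2 + Real.log (sepModulus (4 * (Y₀ + 1)) (M + M) (Y₀ / M))) *
        (Real.sqrt (((M : ℝ) + 1 + 2 * (Q : ℝ) ^ 2) * ∑ d ∈ Ioc M (M + M), a d ^ 2) *
          Real.sqrt ((((Y₀ / M : ℕ) : ℝ) + 1 + 2 * (Q : ℝ) ^ 2) *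
            ∑ m ∈ Ioc 0 (Y₀ / M), b m ^ 2)) := by
  classical
  have h := largeSieve_bilinear_hyperbolic (fun d => (a d : ℂ)) (fun m => (b m : ℂ)) M M 0
    (Y₀ / M) Q Y₀ X hX
  simp only [norm_ofReal_sq] at h
  have e : (fun q (χ : DirichletCharacter ℂ q) => blockSum a b M (X q χ) χ) =
      fun q χ => ∑ d ∈ Ioc M (M + M), ∑ m ∈ Ioc 0 (0 + Y₀ / M),
        (if d * m ≤ X q χ then (a d : ℂ) * (b m : ℂ) * χ (d * m) else 0) := by
    funext q χ; exact blockSum_eq_sum_ite a b hM (hX q χ) χ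
  rw [e]
  unfold Tfun
  rw [zero_add] at h ⊢
  exact h

/-- `2 + log P ≤ 5 ℓ` for the separation modulus `P = sepModulus (4(Y₀+1)) M₁ N₁` of a block
with `M₁ N₁ ≤ 2 Y₀` (`P ≤ (4Y₀ + 5) · 2Y₀ ≤ 18 Y₀²`, `log 18 < 3`). [folklore] -/
theorem two_add_log_sepModulus_le {Y₀ M₁ N₁ : ℕ} (hY : 1 ≤ Y₀) (hM : 1 ≤ M₁) (hN : 1 ≤ N₁)
    (hMN : M₁ * N₁ ≤ 2 * Y₀) :
    2 + Real.log (sepModulus (4 * (Y₀ + 1)) M₁ N₁) ≤ 5 * ell Y₀ := by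
  have hP := sepModulus_le (T := 4 * (Y₀ + 1)) hM hN
  have hY' : (1 : ℝ) ≤ Y₀ := by exact_mod_cast hY
  have hMN' : (M₁ : ℝ) * N₁ ≤ 2 * Y₀ := by exact_mod_cast hMN
  have hP' : (sepModulus (4 * (Y₀ + 1)) M₁ N₁ : ℝ) ≤ 18 * (Y₀ : ℝ) ^ 2 := by
    refine hP.trans ?_
    push_cast
    nlinarith
  have hP0 : (0 : ℝ) < sepModulus (4 * (Y₀ + 1)) M₁ N₁ := by
    exact_mod_cast sepModulus_pos _ _ _
  have h18 : Real.log 18 ≤ 3 := by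
    rw [Real.log_le_iff_le_exp (by norm_num)]
    have h1 := Real.exp_one_gt_d9
    calc (18 : ℝ) ≤ 2.7182818283 ^ 3 := by norm_num
      _ ≤ Real.exp 1 ^ 3 := pow_le_pow_left₀ (by norm_num) h1.le 3
      _ = Real.exp 3 := by rw [← Real.exp_nat_mul]; norm_num
  have hlogP : Real.log (sepModulus (4 * (Y₀ + 1)) M₁ N₁) ≤ Real.log 18 + 2 * Real.log Y₀ := by
    calc Real.log (sepModulus (4 * (Y₀ + 1)) M₁ N₁) ≤ Real.log (18 * (Y₀ : ℝ) ^ 2) :=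
          Real.log_le_log hP0 hP'
      _ = Real.log 18 + 2 * Real.log Y₀ := by
          rw [Real.log_mul (by norm_num) (by positivity), Real.log_pow]; push_cast; ring
  have hlY : 0 ≤ Real.log Y₀ := Real.log_natCast_nonneg Y₀
  unfold ell
  linarith

/-- `√(M + 1 + 2Q²) ≤ 2(√M + Q)` for `M ≥ 1`. [folklore] -/
theorem sqrt_add_one_add_le {M : ℝ} (hM : 1 ≤ M) {Q : ℝ} (hQ : 0 ≤ Q) :
    Real.sqrt (M + 1 + 2 * Q ^ 2) ≤ 2 * (Real.sqrt M + Q) := by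
  rw [Real.sqrt_le_left (by positivity)]
  have h1 : Real.sqrt M ^ 2 = M := Real.sq_sqrt (by linarith)
  have h2 : 1 ≤ Real.sqrt M := by rw [← Real.sqrt_one]; exact Real.sqrt_le_sqrt hM
  nlinarith [Real.sqrt_nonneg M]

/-- **The cleaned-up block bound**: for `1 ≤ M ≤ Y₀`, `∑_{M<d≤2M} a(d)² ≤ A`,
`∑_{m ≤ Y₀/M} b(m)² ≤ B`,
`T(B_M) ≤ 20 ℓ (√M + Q)(√(Y₀/M) + Q) √(AB)`. [folklore] -/
theorem Tfun_blockSum_le (a b : ℕ → ℝ) {Q M Y₀ : ℕ} (hM : 1 ≤ M) (hMY : M ≤ Y₀)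
    (X : (q : ℕ) → DirichletCharacter ℂ q → ℕ) (hX : ∀ q χ, X q χ ≤ Y₀) {A B : ℝ}
    (hA0 : 0 ≤ A) (hA : ∑ d ∈ Ioc M (M + M), a d ^ 2 ≤ A)
    (hB : ∑ m ∈ Ioc 0 (Y₀ / M), b m ^ 2 ≤ B) :
    Tfun Q (fun q χ => blockSum a b M (X q χ) χ) ≤
      20 * ell Y₀ * ((Real.sqrt M + Q) * (Real.sqrt (Y₀ / M : ℕ) + Q)) * Real.sqrt (A * B) := by
  have hY : 1 ≤ Y₀ := hM.trans hMY
  have hN : 1 ≤ Y₀ / M := (Nat.le_div_iff_mul_le hM).2 (by simpa using hMY)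
  have hMN : (M + M) * (Y₀ / M) ≤ 2 * Y₀ := by
    have := Nat.mul_div_le Y₀ M
    rw [← two_mul, mul_assoc]; omega
  have hlog := two_add_log_sepModulus_le hY (by omega : 1 ≤ M + M) hN hMN
  refine (Tfun_blockSum_le_hyperbolic a b (by omega) X hX).trans ?_
  have hsM : Real.sqrt ((M : ℝ) + 1 + 2 * (Q : ℝ) ^ 2) ≤ 2 * (Real.sqrt M + Q) :=
    sqrt_add_one_add_le (by exact_mod_cast hM) (Nat.cast_nonneg Q)
  have hsN : Real.sqrt (((Y₀ / M : ℕ) : ℝ) + 1 + 2 * (Q : ℝ) ^ 2) ≤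
      2 * (Real.sqrt (Y₀ / M : ℕ) + Q) :=
    sqrt_add_one_add_le (by exact_mod_cast hN) (Nat.cast_nonneg Q)
  have hR₁ : Real.sqrt (((M : ℝ) + 1 + 2 * (Q : ℝ) ^ 2) * ∑ d ∈ Ioc M (M + M), a d ^ 2) ≤
      2 * (Real.sqrt M + Q) * Real.sqrt A := by
    rw [Real.sqrt_mul (by positivity)]
    exact mul_le_mul hsM (Real.sqrt_le_sqrt hA) (Real.sqrt_nonneg _) (by positivity)
  have hR₂ : Real.sqrt ((((Y₀ / M : ℕ) : ℝ) + 1 + 2 * (Q : ℝ) ^ 2) *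
      ∑ m ∈ Ioc 0 (Y₀ / M), b m ^ 2) ≤ 2 * (Real.sqrt (Y₀ / M : ℕ) + Q) * Real.sqrt B := by
    rw [Real.sqrt_mul (by positivity)]
    exact mul_le_mul hsN (Real.sqrt_le_sqrt hB) (Real.sqrt_nonneg _) (by positivity)
  have hL0 : 0 ≤ 2 + Real.log (sepModulus (4 * (Y₀ + 1)) (M + M) (Y₀ / M)) := by
    have := Real.log_natCast_nonneg (sepModulus (4 * (Y₀ + 1)) (M + M) (Y₀ / M)); linarith
  have hℓ := ell_nonneg Y₀
  calc _ ≤ (5 * ell Y₀) * ((2 * (Real.sqrt M + Q) * Real.sqrt A) *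
        (2 * (Real.sqrt (Y₀ / M : ℕ) + Q) * Real.sqrt B)) :=
        mul_le_mul hlog (mul_le_mul hR₁ hR₂ (Real.sqrt_nonneg _) (by positivity))
          (mul_nonneg (Real.sqrt_nonneg _) (Real.sqrt_nonneg _)) (by positivity)
    _ = 20 * ell Y₀ * ((Real.sqrt M + Q) * (Real.sqrt (Y₀ / M : ℕ) + Q)) *
        (Real.sqrt A * Real.sqrt B) := by ring
    _ = _ := by rw [← Real.sqrt_mul hA0]

/-- **The piece `S₃`** (Vaughan 1980, §2, the bound for `T₃`):
`T(S₃) ≤ 140 ℓ⁴ √Y₀ (√Y₀ + 2Q √Y₀/√U + Q²)`. [cite: Vaughan1980, §2] -/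
theorem Tfun_S₃_le {Q U Y₀ : ℕ} (hU : 1 ≤ U)
    (X : (q : ℕ) → DirichletCharacter ℂ q → ℕ) (hX : ∀ q χ, X q χ ≤ Y₀) :
    Tfun Q (fun q χ => S₃ U (X q χ) χ) ≤
      140 * ell Y₀ ^ 4 * (Real.sqrt Y₀ *
        (Real.sqrt Y₀ + 2 * Q * (Real.sqrt Y₀ / Real.sqrt U) + (Q : ℝ) ^ 2)) := by
  have hℓ := ell_nonneg Y₀
  obtain ⟨J, hJY, hJℓ⟩ := exists_dyadic_range hU Y₀
  set G : ℝ := 70 * ell Y₀ ^ 3 * (Real.sqrt Y₀ *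
    (Real.sqrt Y₀ + 2 * Q * (Real.sqrt Y₀ / Real.sqrt U) + (Q : ℝ) ^ 2)) with hG
  have hG0 : 0 ≤ G := by positivity
  have hblock : ∀ i ∈ range J,
      Tfun Q (fun q χ => blockSum (fU U) (gU U) (U * 2 ^ i) (X q χ) χ) ≤ G := by
    intro i _
    have hUM : U ≤ U * 2 ^ i := Nat.le_mul_of_pos_right U (Nat.two_pow_pos i)
    have hM1 : 1 ≤ U * 2 ^ i := hU.trans hUM
    rcases le_or_gt Y₀ (U * (U * 2 ^ i)) with hz | hlt
    · rw [Tfun_eq_zero_of_forall fun q _ _ χ => blockSum_fU_gU_eq_zero (hX q χ) hz χ]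
      exact hG0
    · have hMY : U * 2 ^ i ≤ Y₀ := le_trans (Nat.le_mul_of_pos_left _ hU) hlt.le
      have hN : Y₀ / (U * 2 ^ i) ≤ Y₀ := Nat.div_le_self _ _
      have hA0 : (0 : ℝ) ≤ 12 * (U * 2 ^ i : ℕ) * ell Y₀ := by positivity
      refine (Tfun_blockSum_le (fU U) (gU U) hM1 hMY X hX hA0 (sum_sq_fU_le hMY)
        (sum_sq_gU_le hN)).trans ?_
      have hsMN := sqrt_mul_sqrt_div_le (U * 2 ^ i) Y₀
      have hsM : Real.sqrt (U * 2 ^ i : ℕ) ≤ Real.sqrt Y₀ / Real.sqrt U :=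
        sqrt_le_sqrt_div_sqrt hU hlt.le
      have hsN : Real.sqrt (Y₀ / (U * 2 ^ i) : ℕ) ≤ Real.sqrt Y₀ / Real.sqrt U :=
        sqrt_div_le_sqrt_div_sqrt hU hUM
      have hAB : Real.sqrt (12 * (U * 2 ^ i : ℕ) * ell Y₀ *
          ((Y₀ / (U * 2 ^ i) : ℕ) * ell Y₀ ^ 3)) ≤ 7 / 2 * Real.sqrt Y₀ * ell Y₀ ^ 2 := by
        rw [Real.sqrt_le_left (by positivity)]
        have hMN : ((U * 2 ^ i : ℕ) : ℝ) * (Y₀ / (U * 2 ^ i) : ℕ) ≤ Y₀ := by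
          exact_mod_cast Nat.mul_div_le Y₀ (U * 2 ^ i)
        have hY : Real.sqrt Y₀ ^ 2 = Y₀ := Real.sq_sqrt (Nat.cast_nonneg Y₀)
        have h4 : 0 ≤ ell Y₀ ^ 4 := pow_nonneg hℓ 4
        nlinarith [mul_le_mul_of_nonneg_right hMN h4]
      have hprod : (Real.sqrt (U * 2 ^ i : ℕ) + Q) * (Real.sqrt (Y₀ / (U * 2 ^ i) : ℕ) + Q) ≤
          Real.sqrt Y₀ + 2 * Q * (Real.sqrt Y₀ / Real.sqrt U) + (Q : ℝ) ^ 2 := by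
        have hQ0 : (0 : ℝ) ≤ Q := Nat.cast_nonneg Q
        nlinarith [mul_le_mul_of_nonneg_left hsM hQ0, mul_le_mul_of_nonneg_left hsN hQ0]
      calc 20 * ell Y₀ * ((Real.sqrt (U * 2 ^ i : ℕ) + Q) *
            (Real.sqrt (Y₀ / (U * 2 ^ i) : ℕ) + Q)) *
            Real.sqrt (12 * (U * 2 ^ i : ℕ) * ell Y₀ * ((Y₀ / (U * 2 ^ i) : ℕ) * ell Y₀ ^ 3))
          ≤ 20 * ell Y₀ * (Real.sqrt Y₀ + 2 * Q * (Real.sqrt Y₀ / Real.sqrt U) + (Q : ℝ) ^ 2) *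
            (7 / 2 * Real.sqrt Y₀ * ell Y₀ ^ 2) :=
            mul_le_mul (mul_le_mul_of_nonneg_left hprod (by positivity)) hAB
              (Real.sqrt_nonneg _) (by positivity)
        _ = G := by rw [hG]; ring
  have e : (fun q (χ : DirichletCharacter ℂ q) => S₃ U (X q χ) χ) =
      fun q χ => ∑ i ∈ range J, blockSum (fU U) (gU U) (U * 2 ^ i) (X q χ) χ := by
    funext q χ; exact S₃_eq_sum_blockSum ((hX q χ).trans hJY) χ
  rw [e]
  refine (Tfun_sum_le Q (range J)
    fun i q χ => blockSum (fU U) (gU U) (U * 2 ^ i) (X q χ) χ).trans ?_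
  refine (sum_le_sum hblock).trans ?_
  rw [sum_const, card_range, nsmul_eq_mul]
  calc (J : ℝ) * G ≤ 2 * ell Y₀ * G := mul_le_mul_of_nonneg_right hJℓ hG0
    _ = _ := by rw [hG]; ring

/-- **The piece `S₂''`** (Vaughan 1980, §2: "`S₂''` is treated like `S₃`"):
`T(S₂'') ≤ 40 ℓ³ √Y₀ (√Y₀ + UQ + Q √Y₀/√U + Q²)` for `U² ≤ Y₀`. [cite: Vaughan1980, §2] -/
theorem Tfun_S₂''_le {Q U Y₀ : ℕ} (hU : 1 ≤ U) (hUU : U * U ≤ Y₀)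
    (X : (q : ℕ) → DirichletCharacter ℂ q → ℕ) (hX : ∀ q χ, X q χ ≤ Y₀) :
    Tfun Q (fun q χ => S₂'' U (X q χ) χ) ≤
      40 * ell Y₀ ^ 3 * (Real.sqrt Y₀ *
        (Real.sqrt Y₀ + U * Q + Q * (Real.sqrt Y₀ / Real.sqrt U) + (Q : ℝ) ^ 2)) := by
  have hℓ := ell_nonneg Y₀
  obtain ⟨J, hJY, hJℓ⟩ := exists_dyadic_range hU Y₀
  set G : ℝ := 20 * ell Y₀ ^ 2 * (Real.sqrt Y₀ *
    (Real.sqrt Y₀ + U * Q + Q * (Real.sqrt Y₀ / Real.sqrt U) + (Q : ℝ) ^ 2)) with hG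
  have hG0 : 0 ≤ G := by positivity
  have hblock : ∀ i ∈ range J,
      Tfun Q (fun q χ => blockSum (cU U) (fun _ => 1) (U * 2 ^ i) (X q χ) χ) ≤ G := by
    intro i _
    have hUM : U ≤ U * 2 ^ i := Nat.le_mul_of_pos_right U (Nat.two_pow_pos i)
    have hM1 : 1 ≤ U * 2 ^ i := hU.trans hUM
    rcases le_or_gt (U * U) (U * 2 ^ i) with hz | hlt
    · rw [Tfun_eq_zero_of_forall fun q _ _ χ => blockSum_cU_eq_zero hz _ χ]
      exact hG0
    · have hMY : U * 2 ^ i ≤ Y₀ := hlt.le.trans hUU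
      have hA0 : (0 : ℝ) ≤ (U * 2 ^ i : ℕ) * ell Y₀ ^ 2 := by positivity
      have hB : ∑ m ∈ Ioc 0 (Y₀ / (U * 2 ^ i)), (fun _ : ℕ => (1 : ℝ)) m ^ 2 ≤
          (Y₀ / (U * 2 ^ i) : ℕ) := by
        simp only [one_pow, sum_const, Nat.card_Ioc, Nat.sub_zero, nsmul_eq_mul, mul_one, le_refl]
      refine (Tfun_blockSum_le (cU U) (fun _ => 1) hM1 hMY X hX hA0 (sum_sq_cU_le hMY)
        hB).trans ?_
      have hsMN := sqrt_mul_sqrt_div_le (U * 2 ^ i) Y₀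
      have hsM : Real.sqrt (U * 2 ^ i : ℕ) ≤ U := sqrt_le_of_lt_mul_self hlt
      have hsN : Real.sqrt (Y₀ / (U * 2 ^ i) : ℕ) ≤ Real.sqrt Y₀ / Real.sqrt U :=
        sqrt_div_le_sqrt_div_sqrt hU hUM
      have hAB : Real.sqrt ((U * 2 ^ i : ℕ) * ell Y₀ ^ 2 * (Y₀ / (U * 2 ^ i) : ℕ)) ≤
          Real.sqrt Y₀ * ell Y₀ := by
        rw [Real.sqrt_le_left (by positivity)]
        have hMN : ((U * 2 ^ i : ℕ) : ℝ) * (Y₀ / (U * 2 ^ i) : ℕ) ≤ Y₀ := by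
          exact_mod_cast Nat.mul_div_le Y₀ (U * 2 ^ i)
        have hY : Real.sqrt Y₀ ^ 2 = Y₀ := Real.sq_sqrt (Nat.cast_nonneg Y₀)
        have h2 : 0 ≤ ell Y₀ ^ 2 := pow_nonneg hℓ 2
        nlinarith [mul_le_mul_of_nonneg_right hMN h2]
      have hprod : (Real.sqrt (U * 2 ^ i : ℕ) + Q) * (Real.sqrt (Y₀ / (U * 2 ^ i) : ℕ) + Q) ≤
          Real.sqrt Y₀ + U * Q + Q * (Real.sqrt Y₀ / Real.sqrt U) + (Q : ℝ) ^ 2 := by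
        have hQ0 : (0 : ℝ) ≤ Q := Nat.cast_nonneg Q
        nlinarith [mul_le_mul_of_nonneg_left hsM hQ0, mul_le_mul_of_nonneg_left hsN hQ0]
      calc 20 * ell Y₀ * ((Real.sqrt (U * 2 ^ i : ℕ) + Q) *
            (Real.sqrt (Y₀ / (U * 2 ^ i) : ℕ) + Q)) *
            Real.sqrt ((U * 2 ^ i : ℕ) * ell Y₀ ^ 2 * (Y₀ / (U * 2 ^ i) : ℕ))
          ≤ 20 * ell Y₀ * (Real.sqrt Y₀ + U * Q + Q * (Real.sqrt Y₀ / Real.sqrt U) + (Q : ℝ) ^ 2) *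
            (Real.sqrt Y₀ * ell Y₀) :=
            mul_le_mul (mul_le_mul_of_nonneg_left hprod (by positivity)) hAB
              (Real.sqrt_nonneg _) (by positivity)
        _ = G := by rw [hG]; ring
  have e : (fun q (χ : DirichletCharacter ℂ q) => S₂'' U (X q χ) χ) =
      fun q χ => ∑ i ∈ range J, blockSum (cU U) (fun _ => 1) (U * 2 ^ i) (X q χ) χ := by
    funext q χ; exact S₂''_eq_sum_blockSum ((hX q χ).trans hJY) χ
  rw [e]
  refine (Tfun_sum_le Q (range J)
    fun i q χ => blockSum (cU U) (fun _ => 1) (U * 2 ^ i) (X q χ) χ).trans ?_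
  refine (sum_le_sum hblock).trans ?_
  rw [sum_const, card_range, nsmul_eq_mul]
  calc (J : ℝ) * G ≤ 2 * ell Y₀ * G := mul_le_mul_of_nonneg_right hJℓ hG0
    _ = _ := by rw [hG]; ring

/-! ### The case `Q² > Y` -/

open scoped Classical in
/-- **The case `Q² > Y₀`** (Vaughan 1980, §2: "Theorem 1 follows at once from Lemma 2 on taking
`M = 1`, `a₁ = 1`, `b_n = Λ(n)`"): `T(ψ) ≤ 50 Q² √Y₀ ℓ²`. [cite: Vaughan1980, §2] -/
theorem Tfun_psi_le_of_lt_sq {Q Y₀ : ℕ} (hY : 1 ≤ Y₀) (hQY : Y₀ + 1 ≤ Q * Q)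
    (X : (q : ℕ) → DirichletCharacter ℂ q → ℕ) (hX : ∀ q χ, X q χ ≤ Y₀) :
    Tfun Q (fun q χ => chebyshevPsiChar χ (X q χ)) ≤
      50 * (Q : ℝ) ^ 2 * Real.sqrt Y₀ * ell Y₀ ^ 2 := by
  classical
  have h : ∑ q ∈ Icc 1 Q, (q : ℝ) / q.totient *
      ∑ χ : DirichletCharacter ℂ q with χ.IsPrimitive,
        ‖∑ m ∈ Ioc 0 (0 + 1), ∑ n ∈ Ioc 0 (0 + Y₀),
          (if m * n ≤ X q χ then (1 : ℂ) * ((Λ n : ℝ) : ℂ) * χ (m * n) else 0)‖ ≤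
      (2 + Real.log (sepModulus (4 * (Y₀ + 1)) (0 + 1) (0 + Y₀))) *
        (Real.sqrt ((((1 : ℕ) : ℝ) + 1 + 2 * (Q : ℝ) ^ 2) *
            ∑ m ∈ Ioc 0 (0 + 1), ‖(1 : ℂ)‖ ^ 2) *
          Real.sqrt (((Y₀ : ℝ) + 1 + 2 * (Q : ℝ) ^ 2) *
            ∑ n ∈ Ioc 0 (0 + Y₀), ‖((Λ n : ℝ) : ℂ)‖ ^ 2)) :=
    largeSieve_bilinear_hyperbolic (fun _ => (1 : ℂ)) (fun n => ((Λ n : ℝ) : ℂ)) 0 1 0 Y₀ Q Y₀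
      X hX
  have e : (fun q (χ : DirichletCharacter ℂ q) => chebyshevPsiChar χ (X q χ)) = fun q χ =>
      ∑ m ∈ Ioc 0 (0 + 1), ∑ n ∈ Ioc 0 (0 + Y₀),
        (if m * n ≤ X q χ then (1 : ℂ) * ((Λ n : ℝ) : ℂ) * χ (m * n) else 0) := by
    funext q χ; exact chebyshevPsiChar_eq_sum_ite (hX q χ) χ
  rw [e]
  unfold Tfun
  refine h.trans ?_
  have h1 : ∑ m ∈ Ioc 0 (0 + 1), ‖(1 : ℂ)‖ ^ 2 = 1 := by simp
  have h2 : ∑ n ∈ Ioc 0 (0 + Y₀), ‖((Λ n : ℝ) : ℂ)‖ ^ 2 = ∑ n ∈ Ioc 0 Y₀, Λ n ^ 2 := by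
    rw [zero_add]; exact sum_congr rfl fun n _ => norm_ofReal_sq _
  rw [h1, h2, zero_add, zero_add, Nat.cast_one, mul_one]
  have hℓ := ell_nonneg Y₀
  have hℓ1 := one_le_ell Y₀
  have hlog : 2 + Real.log (sepModulus (4 * (Y₀ + 1)) 1 Y₀) ≤ 5 * ell Y₀ :=
    two_add_log_sepModulus_le hY le_rfl hY (by omega)
  have hQ : (Y₀ : ℝ) + 1 ≤ (Q : ℝ) ^ 2 := by rw [sq]; exact_mod_cast hQY
  have hs1 : Real.sqrt (1 + 1 + 2 * (Q : ℝ) ^ 2) ≤ 2 * Q := by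
    rw [Real.sqrt_le_left (by positivity)]
    have : (1 : ℝ) ≤ Y₀ := by exact_mod_cast hY
    nlinarith
  have hΛ : ∑ n ∈ Ioc 0 Y₀, Λ n ^ 2 ≤ 6 * Y₀ * ell Y₀ := by
    refine (sum_vonMangoldt_sq_le Y₀).trans ?_
    have h6 := log_four_add_four_le_six
    have h3 : Real.log Y₀ ≤ ell Y₀ := log_le_ell le_rfl
    have h4 : 0 ≤ Real.log (Y₀ : ℝ) := Real.log_natCast_nonneg _
    have h5 : 0 ≤ Real.log 4 := Real.log_nonneg (by norm_num)
    exact mul_le_mul (mul_le_mul_of_nonneg_right h6 (Nat.cast_nonneg _)) h3 h4 (by positivity)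
  have hS0 : 0 ≤ ∑ n ∈ Ioc 0 Y₀, Λ n ^ 2 := sum_nonneg fun _ _ => by positivity
  have hs2 : Real.sqrt (((Y₀ : ℝ) + 1 + 2 * (Q : ℝ) ^ 2) * ∑ n ∈ Ioc 0 Y₀, Λ n ^ 2) ≤
      5 * Q * Real.sqrt Y₀ * ell Y₀ := by
    rw [Real.sqrt_le_left (by positivity)]
    have hc : (Y₀ : ℝ) + 1 + 2 * (Q : ℝ) ^ 2 ≤ 3 * (Q : ℝ) ^ 2 := by linarith
    have hp := mul_le_mul hc hΛ hS0 (by positivity)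
    have hY' : Real.sqrt Y₀ ^ 2 = Y₀ := Real.sq_sqrt (Nat.cast_nonneg Y₀)
    have hℓ2 : ell Y₀ ≤ ell Y₀ ^ 2 := by nlinarith
    have hQY0 : 0 ≤ (Q : ℝ) ^ 2 * Y₀ := by positivity
    have e5 : (5 * (Q : ℝ) * Real.sqrt Y₀ * ell Y₀) ^ 2 = 25 * ((Q : ℝ) ^ 2 * Y₀) * ell Y₀ ^ 2 := by
      rw [mul_pow, mul_pow, mul_pow, hY']; ring
    rw [e5]
    have hm : (Q : ℝ) ^ 2 * Y₀ * ell Y₀ ≤ (Q : ℝ) ^ 2 * Y₀ * ell Y₀ ^ 2 :=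
      mul_le_mul_of_nonneg_left hℓ2 hQY0
    have h7 : 0 ≤ (Q : ℝ) ^ 2 * Y₀ * ell Y₀ ^ 2 := by positivity
    linarith
  calc _ ≤ (5 * ell Y₀) * ((2 * Q) * (5 * Q * Real.sqrt Y₀ * ell Y₀)) :=
        mul_le_mul hlog (mul_le_mul hs1 hs2 (Real.sqrt_nonneg _) (by positivity))
          (mul_nonneg (Real.sqrt_nonneg _) (Real.sqrt_nonneg _)) (by positivity)
    _ = _ := by ring

/-! ### The case `Q² ≤ Y`: all pieces together -/

/-- **The case `Q² ≤ Y₀`** (Vaughan 1980, §2): for `1 ≤ U`, `U² ≤ Y₀` and cut-offs `X ≤ Y₀`,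
`T(ψ) ≤ T(ψ(min(U,·))) + T(S₁) + T(S₂') + T(S₂'') + T(S₃)`, each piece bounded as above.
[cite: Vaughan1980, §2] -/
theorem Tfun_psi_le_pieces {Q U Y₀ : ℕ} (hQ : 1 ≤ Q) (hU : 1 ≤ U) (hUU : U * U ≤ Y₀)
    (X : (q : ℕ) → DirichletCharacter ℂ q → ℕ) (hX : ∀ q χ, X q χ ≤ Y₀) :
    Tfun Q (fun q χ => chebyshevPsiChar χ (X q χ)) ≤
      (Real.log 4 + 4) * U * (Q : ℝ) ^ 2 +
      2 * (Y₀ * ell Y₀ ^ 2 + U * ell Y₀ * ((Q : ℝ) ^ 2 * Real.sqrt Q * (1 + Real.log Q))) +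
      40 * ell Y₀ ^ 3 * (Real.sqrt Y₀ *
        (Real.sqrt Y₀ + U * Q + Q * (Real.sqrt Y₀ / Real.sqrt U) + (Q : ℝ) ^ 2)) +
      140 * ell Y₀ ^ 4 * (Real.sqrt Y₀ *
        (Real.sqrt Y₀ + 2 * Q * (Real.sqrt Y₀ / Real.sqrt U) + (Q : ℝ) ^ 2)) := by
  have hUY : U ≤ Y₀ := le_trans (Nat.le_mul_of_pos_left U hU) hUU
  have e : (fun q (χ : DirichletCharacter ℂ q) => chebyshevPsiChar χ (X q χ)) = fun q χ =>
      chebyshevPsiChar χ ((min U (X q χ) : ℕ) : ℝ) + S₁ U (X q χ) χ -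
        (S₂' U (X q χ) χ + S₂'' U (X q χ) χ) + S₃ U (X q χ) χ := by
    funext q χ; rw [← S₂_eq_add]; exact chebyshevPsiChar_eq_decomposition U (X q χ) χ
  rw [e]
  have h0 := Tfun_psi_min_le Q U X
  have h1 := Tfun_S₁_le hQ hUY X hX
  have h2 := Tfun_S₂'_le hQ hUY X hX
  have h3 := Tfun_S₂''_le (Q := Q) hU hUU X hX
  have h4 := Tfun_S₃_le (Q := Q) hU X hX
  have step1 := Tfun_add_le Q
    (fun q χ => chebyshevPsiChar χ ((min U (X q χ) : ℕ) : ℝ) + S₁ U (X q χ) χ -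
      (S₂' U (X q χ) χ + S₂'' U (X q χ) χ))
    (fun q χ => S₃ U (X q χ) χ)
  have step2 := Tfun_sub_le Q
    (fun q χ => chebyshevPsiChar χ ((min U (X q χ) : ℕ) : ℝ) + S₁ U (X q χ) χ)
    (fun q χ => S₂' U (X q χ) χ + S₂'' U (X q χ) χ)
  have step3 := Tfun_add_le Q (fun q χ => chebyshevPsiChar χ ((min U (X q χ) : ℕ) : ℝ))
    (fun q χ => S₁ U (X q χ) χ)
  have step4 := Tfun_add_le Q (fun q χ => S₂' U (X q χ) χ) (fun q χ => S₂'' U (X q χ) χ)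
  linarith

/-! ### The choice `u = min(Y^{1/3}, Y Q⁻²)` and the final inequality -/

/-- The algebra behind the terms `Y₀ Q/√U` (Vaughan 1980, (10): with `u = min(Y^{1/3}, YQ⁻²)`
one has `Y Q u^{-1/2} ≤ Y^{5/6} Q + Y^{1/2} Q²`); here `A = Y^{1/6}`, `W² U ≤ A¹²`, `u ≤ 2U`.
[cite: Vaughan1980, (10)] -/
theorem alg_W {A Q u U W : ℝ} (hA : 0 < A) (hQ : 1 ≤ Q)
    (hu : u = min (A ^ 2) (A ^ 6 / Q ^ 2)) (huU : u ≤ 2 * U)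
    (hW0 : 0 ≤ W) (hWU : W ^ 2 * U ≤ A ^ 12) :
    Q * W ≤ 2 * (A ^ 5 * Q + A ^ 3 * Q ^ 2) := by
  have hQ0 : 0 < Q := by linarith
  have h1 : W ^ 2 * u ≤ 2 * A ^ 12 := by nlinarith [sq_nonneg W]
  have h5 : 0 < A ^ 5 := pow_pos hA 5
  have h3 : 0 < A ^ 3 := pow_pos hA 3
  rcases min_choice (A ^ 2) (A ^ 6 / Q ^ 2) with h | h <;> rw [h] at hu <;> rw [hu] at h1
  · have h2 : W ^ 2 ≤ 2 * A ^ 10 := by nlinarith [pow_pos hA 2]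
    have h4 : W ^ 2 ≤ (2 * A ^ 5) ^ 2 := by nlinarith
    have h6 : W ≤ 2 * A ^ 5 := (pow_le_pow_iff_left₀ hW0 (by positivity) two_ne_zero).1 h4
    nlinarith [mul_le_mul_of_nonneg_left h6 hQ0.le]
  · have h2 : W ^ 2 * A ^ 6 ≤ 2 * A ^ 12 * Q ^ 2 := by
      have := mul_le_mul_of_nonneg_right h1 (sq_nonneg Q)
      rwa [mul_assoc, div_mul_cancel₀ _ (by positivity)] at this
    have h4 : W ^ 2 ≤ 2 * A ^ 6 * Q ^ 2 := by nlinarith [pow_pos hA 6]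
    have h6 : W ^ 2 ≤ (2 * A ^ 3 * Q) ^ 2 := by nlinarith [sq_nonneg (A ^ 3 * Q)]
    have h7 : W ≤ 2 * A ^ 3 * Q := (pow_le_pow_iff_left₀ hW0 (by positivity) two_ne_zero).1 h6
    nlinarith [mul_le_mul_of_nonneg_left h7 hQ0.le]

end Literature.NumberTheory.Sieve.Vaughan

namespace Literature.NumberTheory.Sieve

open Vaughan LargeSieve

/-- **Vaughan's mean value theorem** (Vaughan, Acta Arith. 37 (1980), Theorem 1), discharged:
for integers `Q ≥ 1` and real `Y ≥ 2`,
`∑_{q ≤ Q} (q/φ(q)) ∑*_{χ mod q} max_{y ≤ Y} |ψ(y, χ)| ≤ 10⁵ (Y + Y^{5/6} Q + Y^{1/2} Q²) L⁴`,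
`L = log(YQ)`. The proof follows Vaughan's paper: Vaughan's identity with
`u = min(Y^{1/3}, YQ⁻²)` (the parameter `Q²` in Vaughan's (10) is not needed), the pieces `S₁`,
`S₂'` by the Pólya–Vinogradov inequality, the pieces `S₂''`, `S₃` in dyadic blocks by the
bilinear large sieve with the hyperbolic cut-off (`largeSieve_bilinear_hyperbolic`, the
Perron-free form of Vaughan's Lemma 2), and the case `Q² > Y` by Lemma 2 with `M = 1`.
[cite: Vaughan1980, Theorem 1] -/
theorem vaughan_meanValue_holds : vaughan_meanValue := by
  refine ⟨100000, fun Q hQ Y hY => ?_⟩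
  obtain ⟨X, hXle, hT⟩ := exists_cutoff Q Y
  rw [hT]
  clear hT
  obtain ⟨Y₀, hY₀def⟩ : ∃ Y₀ : ℕ, Y₀ = ⌊Y⌋₊ := ⟨_, rfl⟩
  rw [← hY₀def] at hXle
  have hY1 : (1 : ℝ) ≤ Y := by linarith
  have hY0 : (0 : ℝ) ≤ Y := by linarith
  have hY₀2 : 2 ≤ Y₀ := by rw [hY₀def]; exact Nat.le_floor (by exact_mod_cast hY)
  have hY₀1 : 1 ≤ Y₀ := by omega
  have hY₀Y : (Y₀ : ℝ) ≤ Y := by rw [hY₀def]; exact Nat.floor_le hY0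
  have hY₀0 : (0 : ℝ) ≤ Y₀ := Nat.cast_nonneg Y₀
  have hQ1 : (1 : ℝ) ≤ Q := by exact_mod_cast hQ
  have hQ0 : (0 : ℝ) < Q := by linarith
  -- the logarithms
  obtain ⟨L, hLdef⟩ : ∃ L : ℝ, L = Real.log (Y * Q) := ⟨_, rfl⟩
  rw [← hLdef]
  have hL : Real.log Y ≤ L := by
    rw [hLdef]; exact Real.log_le_log (by linarith) (le_mul_of_one_le_right hY0 hQ1)
  have hlog2 : Real.log 2 ≤ Real.log Y := Real.log_le_log two_pos hY
  have h2L : 1 ≤ 2 * L := by have := Real.log_two_gt_d9; linarith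
  have hL0 : 0 ≤ L := by linarith
  have hℓ : ell Y₀ ≤ 3 * L := by
    unfold ell
    have : Real.log Y₀ ≤ Real.log Y :=
      Real.log_le_log (by exact_mod_cast (by omega : 0 < Y₀)) hY₀Y
    linarith
  have hℓ1 := one_le_ell Y₀
  have hℓ0 := ell_nonneg Y₀
  have hℓ4 : ell Y₀ ^ 4 ≤ 81 * L ^ 4 := by
    calc ell Y₀ ^ 4 ≤ (3 * L) ^ 4 := pow_le_pow_left₀ hℓ0 hℓ 4
      _ = 81 * L ^ 4 := by ring
  -- `A = Y^{1/6}`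
  obtain ⟨A, hA⟩ : ∃ A : ℝ, A = Y ^ (1 / 6 : ℝ) := ⟨_, rfl⟩
  have hA0 : 0 < A := by rw [hA]; exact Real.rpow_pos_of_pos (by linarith) _
  have hApow : ∀ n : ℕ, A ^ n = Y ^ ((n : ℝ) / 6) := fun n => by
    rw [hA, ← Real.rpow_natCast, ← Real.rpow_mul hY0]; congr 1; ring
  have hA6 : A ^ 6 = Y := by rw [hApow]; norm_num
  have hA3 : Y ^ (1 / 2 : ℝ) = A ^ 3 := by rw [hApow]; norm_num
  have hA5 : Y ^ (5 / 6 : ℝ) = A ^ 5 := by rw [hApow]; norm_num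
  have hA1 : 1 ≤ A := by rw [hA]; exact Real.one_le_rpow hY1 (by norm_num)
  have hsY : Real.sqrt Y₀ ≤ A ^ 3 := by
    calc Real.sqrt Y₀ ≤ Real.sqrt Y := Real.sqrt_le_sqrt hY₀Y
      _ = A ^ 3 := by
          rw [← hA6, show A ^ 6 = (A ^ 3) ^ 2 by ring, Real.sqrt_sq (by positivity)]
  have hsY0 : 0 ≤ Real.sqrt Y₀ := Real.sqrt_nonneg _
  rw [hA3, hA5]
  obtain ⟨S, hS⟩ : ∃ S : ℝ, S = Y + A ^ 5 * Q + A ^ 3 * (Q : ℝ) ^ 2 := ⟨_, rfl⟩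
  rw [← hS]
  have hS1 : 0 ≤ A ^ 5 * Q + A ^ 3 * (Q : ℝ) ^ 2 := by positivity
  have hS2 : 0 ≤ A ^ 3 * (Q : ℝ) ^ 2 := by positivity
  have hS0 : 0 ≤ S := by rw [hS]; positivity
  have hSL : 0 ≤ S * L ^ 4 := by positivity
  rcases lt_or_ge Y₀ (Q * Q) with hcase | hcase
  · -- the case `Q² > Y₀`
    have hTA := Tfun_psi_le_of_lt_sq hY₀1 hcase X hXle
    have h1 : ell Y₀ ^ 2 ≤ 9 * L ^ 2 := by
      calc ell Y₀ ^ 2 ≤ (3 * L) ^ 2 := pow_le_pow_left₀ hℓ0 hℓ 2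
        _ = 9 * L ^ 2 := by ring
    have h2 : L ^ 2 ≤ 4 * L ^ 4 := by
      have h := mul_nonneg (mul_nonneg (sq_nonneg L) (by linarith : (0 : ℝ) ≤ 2 * L - 1))
        (by linarith : (0 : ℝ) ≤ 2 * L + 1)
      nlinarith only [h]
    have h3 : Real.sqrt Y₀ * ell Y₀ ^ 2 ≤ A ^ 3 * (9 * L ^ 2) :=
      mul_le_mul hsY h1 (by positivity) (by positivity)
    have h4 : 50 * (Q : ℝ) ^ 2 * Real.sqrt Y₀ * ell Y₀ ^ 2 ≤
        1800 * (A ^ 3 * (Q : ℝ) ^ 2) * L ^ 4 := by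
      have hQ2 : 0 ≤ 50 * (Q : ℝ) ^ 2 := by positivity
      have hQ3 : 0 ≤ 450 * (Q : ℝ) ^ 2 * A ^ 3 := by positivity
      nlinarith only [mul_le_mul_of_nonneg_left h3 hQ2, mul_le_mul_of_nonneg_left h2 hQ3]
    have h5 : 0 ≤ (Y + A ^ 5 * Q) * L ^ 4 := by positivity
    have h6 : 0 ≤ A ^ 3 * (Q : ℝ) ^ 2 * L ^ 4 := by positivity
    calc _ ≤ _ := hTA
      _ ≤ 1800 * (A ^ 3 * (Q : ℝ) ^ 2) * L ^ 4 := h4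
      _ ≤ 100000 * S * L ^ 4 := by rw [hS]; nlinarith only [h5, h6]
  · -- the case `Q² ≤ Y₀`: `u = min(Y^{1/3}, Y/Q²)`, `U = ⌊u⌋`
    have hQQY : (Q : ℝ) ^ 2 ≤ Y := by
      have : ((Q * Q : ℕ) : ℝ) ≤ Y₀ := by exact_mod_cast hcase
      push_cast at this; nlinarith only [this, hY₀Y]
    obtain ⟨u, hu⟩ : ∃ u : ℝ, u = min (A ^ 2) (A ^ 6 / (Q : ℝ) ^ 2) := ⟨_, rfl⟩
    have hu1 : 1 ≤ u := by
      rw [hu]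
      refine le_min (by nlinarith only [hA1]) ?_
      rw [le_div_iff₀ (by positivity), one_mul, hA6]; exact hQQY
    have hu0 : 0 ≤ u := by linarith
    obtain ⟨U, hUdef⟩ : ∃ U : ℕ, U = ⌊u⌋₊ := ⟨_, rfl⟩
    have hU1 : 1 ≤ U := by rw [hUdef]; exact (Nat.one_le_floor_iff u).2 hu1
    have hU1' : (1 : ℝ) ≤ U := by exact_mod_cast hU1
    have hU0 : (0 : ℝ) < U := by linarith
    have hUu : (U : ℝ) ≤ u := by rw [hUdef]; exact Nat.floor_le hu0
    have huU : u ≤ 2 * U := by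
      have h1 : u < U + 1 := by rw [hUdef]; exact Nat.lt_floor_add_one u
      linarith
    have hUA2 : (U : ℝ) ≤ A ^ 2 := hUu.trans (by rw [hu]; exact min_le_left _ _)
    have hUQ : (U : ℝ) * (Q : ℝ) ^ 2 ≤ A ^ 6 := by
      have : (U : ℝ) ≤ A ^ 6 / (Q : ℝ) ^ 2 := hUu.trans (by rw [hu]; exact min_le_right _ _)
      rwa [le_div_iff₀ (by positivity)] at this
    have hUUY₀ : U * U ≤ Y₀ := by
      rw [hY₀def]
      refine Nat.le_floor ?_
      push_cast
      have h2 : (U : ℝ) * U ≤ (U : ℝ) ^ 3 := by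
        nlinarith only [mul_nonneg (mul_self_nonneg (U : ℝ)) (sub_nonneg.2 hU1')]
      have h3 : (U : ℝ) ^ 3 ≤ (A ^ 2) ^ 3 := pow_le_pow_left₀ (by positivity) hUA2 3
      calc (U : ℝ) * U ≤ (U : ℝ) ^ 3 := h2
        _ ≤ (A ^ 2) ^ 3 := h3
        _ = Y := by rw [← hA6]; ring
    have hTB := Tfun_psi_le_pieces hQ hU1 hUUY₀ X hXle
    -- the elementary quantities
    have hsU0 : 0 < Real.sqrt U := Real.sqrt_pos.2 hU0
    have hsU : Real.sqrt U ^ 2 = U := Real.sq_sqrt (Nat.cast_nonneg U)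
    have hsQ : Real.sqrt Q ^ 2 = Q := Real.sq_sqrt (Nat.cast_nonneg Q)
    have hsQ0 : 0 ≤ Real.sqrt Q := Real.sqrt_nonneg _
    have hlQ : 1 + Real.log Q ≤ ell Y₀ :=
      one_add_log_le_ell (le_trans (Nat.le_mul_of_pos_left Q hQ) hcase)
    have hlQ0 : 0 ≤ 1 + Real.log (Q : ℝ) := by
      have := Real.log_natCast_nonneg Q; linarith
    -- piece 0
    have s0 : (Real.log 4 + 4) * U * (Q : ℝ) ^ 2 ≤ 6 * Y := by
      have h6 := log_four_add_four_le_six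
      have h4 : 0 ≤ Real.log 4 := Real.log_nonneg (by norm_num)
      have : 0 ≤ (U : ℝ) * (Q : ℝ) ^ 2 := by positivity
      nlinarith only [h6, h4, this, hUQ, hA6]
    -- piece 1: `U Q^{3/2} ≤ Y^{5/6}`
    have s2 : (U : ℝ) * Q * Real.sqrt Q ≤ A ^ 5 := by
      have hV0 : 0 ≤ (U : ℝ) * Q * Real.sqrt Q := by positivity
      refine (pow_le_pow_iff_left₀ hV0 (by positivity) (by norm_num : (4 : ℕ) ≠ 0)).1 ?_
      calc ((U : ℝ) * Q * Real.sqrt Q) ^ 4 = (U : ℝ) * ((U : ℝ) * (Q : ℝ) ^ 2) ^ 3 := by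
            rw [show ((U : ℝ) * Q * Real.sqrt Q) ^ 4 =
              (U : ℝ) ^ 4 * (Q : ℝ) ^ 4 * (Real.sqrt Q ^ 2) ^ 2 by ring, hsQ]; ring
        _ ≤ A ^ 2 * (A ^ 6) ^ 3 :=
            mul_le_mul hUA2 (pow_le_pow_left₀ (by positivity) hUQ 3) (by positivity)
              (by positivity)
        _ = (A ^ 5) ^ 4 := by ring
    have s1 : 2 * (Y₀ * ell Y₀ ^ 2 + U * ell Y₀ * ((Q : ℝ) ^ 2 * Real.sqrt Q * (1 + Real.log Q)))
        ≤ 2 * (ell Y₀ ^ 2 * (Y + A ^ 5 * Q)) := by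
      have h1 : (Y₀ : ℝ) * ell Y₀ ^ 2 ≤ Y * ell Y₀ ^ 2 :=
        mul_le_mul_of_nonneg_right hY₀Y (by positivity)
      have h2 : (U : ℝ) * ell Y₀ * ((Q : ℝ) ^ 2 * Real.sqrt Q * (1 + Real.log Q)) ≤
          ell Y₀ ^ 2 * (A ^ 5 * Q) := by
        calc (U : ℝ) * ell Y₀ * ((Q : ℝ) ^ 2 * Real.sqrt Q * (1 + Real.log Q))
            = ell Y₀ * Q * ((1 + Real.log Q) * ((U : ℝ) * Q * Real.sqrt Q)) := by ring
          _ ≤ ell Y₀ * Q * (ell Y₀ * A ^ 5) :=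
              mul_le_mul_of_nonneg_left (mul_le_mul hlQ s2 (by positivity) hℓ0) (by positivity)
          _ = _ := by ring
      nlinarith only [h1, h2]
    -- pieces 2 and 3
    have s4 : Real.sqrt Y₀ * U * Q ≤ A ^ 5 * Q := by
      have := mul_le_mul hsY hUA2 (by positivity) (by positivity)
      nlinarith only [this, hQ0.le]
    have s5 : (Q : ℝ) * (Real.sqrt Y₀ * (Real.sqrt Y₀ / Real.sqrt U)) ≤
        2 * (A ^ 5 * Q + A ^ 3 * (Q : ℝ) ^ 2) := by
      refine alg_W hA0 hQ1 hu huU (by positivity) ?_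
      have e1 : Real.sqrt Y₀ * (Real.sqrt Y₀ / Real.sqrt U) = Y₀ / Real.sqrt U := by
        rw [← mul_div_assoc, Real.mul_self_sqrt hY₀0]
      rw [e1, div_pow, hsU, div_mul_cancel₀ _ hU0.ne']
      calc (Y₀ : ℝ) ^ 2 ≤ Y ^ 2 := pow_le_pow_left₀ hY₀0 hY₀Y 2
        _ = A ^ 12 := by rw [← hA6]; ring
    have s6 : Real.sqrt Y₀ * (Q : ℝ) ^ 2 ≤ A ^ 3 * (Q : ℝ) ^ 2 :=
      mul_le_mul_of_nonneg_right hsY (by positivity)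
    have s3 : Real.sqrt Y₀ * Real.sqrt Y₀ ≤ Y := by rw [Real.mul_self_sqrt hY₀0]; exact hY₀Y
    have hb2 : Real.sqrt Y₀ *
        (Real.sqrt Y₀ + U * Q + Q * (Real.sqrt Y₀ / Real.sqrt U) + (Q : ℝ) ^ 2) ≤ 3 * S := by
      rw [hS]; nlinarith only [s3, s4, s5, s6, hY0, hS1, hS2]
    have hb3 : Real.sqrt Y₀ *
        (Real.sqrt Y₀ + 2 * Q * (Real.sqrt Y₀ / Real.sqrt U) + (Q : ℝ) ^ 2) ≤ 5 * S := by
      have hS3 : 0 ≤ A ^ 5 * (Q : ℝ) := by positivity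
      rw [hS]; nlinarith only [s3, s5, s6, hY0, hS1, hS2, hS3]
    have hb2' := mul_le_mul_of_nonneg_left hb2 (by positivity : (0 : ℝ) ≤ 40 * ell Y₀ ^ 3)
    have hb3' := mul_le_mul_of_nonneg_left hb3 (by positivity : (0 : ℝ) ≤ 140 * ell Y₀ ^ 4)
    -- collecting: `T ≤ 6Y + 2ℓ²(Y + A⁵Q) + 120 ℓ³ S + 700 ℓ⁴ S ≤ 828 ℓ⁴ S ≤ 828 · 81 L⁴ S`
    have hYS : Y ≤ S := by rw [hS]; linarith
    have hYAS : Y + A ^ 5 * Q ≤ S := by rw [hS]; linarith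
    have hp2 : ell Y₀ ^ 2 ≤ ell Y₀ ^ 4 := pow_le_pow_right₀ hℓ1 (by norm_num)
    have hp3 : ell Y₀ ^ 3 ≤ ell Y₀ ^ 4 := pow_le_pow_right₀ hℓ1 (by norm_num)
    have hp0 : 1 ≤ ell Y₀ ^ 4 := one_le_pow₀ hℓ1
    have k1 := mul_le_mul_of_nonneg_left hYAS (by positivity : (0 : ℝ) ≤ ell Y₀ ^ 2)
    have k2 := mul_le_mul_of_nonneg_right hp2 hS0
    have k3 := mul_le_mul_of_nonneg_right hp3 hS0
    have k4 := mul_le_mul_of_nonneg_right hp0 hS0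
    have k5 := mul_le_mul_of_nonneg_right hℓ4 hS0
    calc _ ≤ _ := hTB
      _ ≤ 6 * Y + 2 * (ell Y₀ ^ 2 * (Y + A ^ 5 * Q)) + 40 * ell Y₀ ^ 3 * (3 * S) +
          140 * ell Y₀ ^ 4 * (5 * S) := by linarith only [hTB, s0, s1, hb2', hb3']
      _ ≤ 828 * (ell Y₀ ^ 4 * S) := by nlinarith only [hYS, k1, k2, k3, k4, hS0]
      _ ≤ 100000 * S * L ^ 4 := by nlinarith only [k5, hSL]


/-- **Bombieri–Vinogradov from Siegel–Walfisz**: with Vaughan's mean value theorem discharged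
(`vaughan_meanValue_holds`), the classical reduction
`bombieri_vinogradov_of_vaughan_of_siegelWalfisz` (`BombieriVinogradovReduction.lean`) leaves the
Siegel–Walfisz theorem `Literature.NumberTheory.Sieve.siegel_walfisz` (parity.S28) as the only remaining input of
`Literature.NumberTheory.Sieve.bombieri_vinogradov` (parity.S27; Vaughan 1980, Theorem 3).
[cite: Vaughan1980, Theorem 3] -/
theorem bombieri_vinogradov_of_siegelWalfisz (hSW : siegel_walfisz) : bombieri_vinogradov :=
  bombieri_vinogradov_of_vaughan_of_siegelWalfisz vaughan_meanValue_holds hSW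

end Literature.NumberTheory.Sieve
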